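import Summits.Ventures.PercRepro.ProfilePointedCircuitClassesStarSharpPencilE

/-!
# PercRepro — THE PENCIL THROUGH `ℓ ∈ X`, PART F: AT MOST TWO D1 DEMANDS; THE X-CLASS COUNT
(p5, gen 56; `proofs/P5-GM1.md` §83)

Two distinct D1 demands are disjoint pairs (`pencilX_D1_disjoint`: a common point `s` makes the plane `cl{e, ℓ, t′}`
contain `π₁`, `π₂` and both complements, so `X` would have rank 3); pairwise disjoint pairs in the 5-set `X` number at
most two (`card_le_two_of_pairwise_disjoint_pairs`), so `|D1| ≤ 2` (`pencilX_card_X_le_two`), and the X-class count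
follows from the two free cross bi-bases of part E (`pencilX_card_X_le`).
-/

open scoped Matroid

namespace PercRepro.Cogirth

open Finset ThmH Skew Shadow Profile

open Classical

variable {α : Type} [DecidableEq α] {N : Matroid α} [N.Finite]

section StarSharpPencilF

variable {b b' : α}

/-- `{ℓ, s} + e ⊆ {ℓ, t′} + e + s`. -/
theorem insert_e_ls_subset_insert_s (e l s t' : α) :
    insert e ({l, s} : Finset α) ⊆ insert s (insert e {l, t'}) := by
  intro z hz; simp only [mem_insert, mem_singleton] at hz ⊢; tauto

/-- **TWO DISTINCT D1 DEMANDS ARE DISJOINT PAIRS**. -/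
theorem pencilX_D1_disjoint (hn : (gr N).card = 9) (hR : rk N (gr N) = 5) (h : SeriesPair N b b') {e f : α}
    (he : e ∈ gr N) (hf : f ∈ gr N) (hef : e ≠ f) (heb : e ≠ b) (heb' : e ≠ b') (hfb : f ≠ b) (hfb' : f ≠ b')
    (he1 : ∀ y ∈ ((((gr N).erase b).erase b').erase f).erase e, rk N {e, y} = 2)
    (hfc : ∀ y ∈ ((((gr N).erase b).erase b').erase f).erase e, rk N (((((gr N).erase b).erase b').erase f).erase y) = 4)
    (hX : rk N (((((gr N).erase b).erase b').erase f).erase e) = 4) (heb3 : rk N {e, b, b'} = 3)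
    (hbg : ∀ y ∈ ((((gr N).erase b).erase b').erase f).erase e, rk N {y, b, b'} = 3)
    {l : α} (hlX : l ∈ ((((gr N).erase b).erase b').erase f).erase e) (hlon : rk N (insert b (insert b' {e, l})) = 3)
    {W₁ W₂ : Finset α} (hW₁ : W₁ ∈ d0DON N b' e f) (hc1₁ : d0c1 N b e f W₁) (hc2₁ : ¬ d0c2 N b b' e f W₁)
    (hl₁ : l ∉ W₁) (hW₂ : W₂ ∈ d0DON N b' e f) (hc1₂ : d0c1 N b e f W₂) (hc2₂ : ¬ d0c2 N b b' e f W₂)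
    (hl₂ : l ∉ W₂) (hne : W₁ ≠ W₂) :
    ∀ u ∈ (W₁.erase b).erase e, u ∉ (W₂.erase b).erase e := by
  set X := ((((gr N).erase b).erase b').erase f).erase e with hXdef
  have hXg : X ⊆ gr N :=
    (erase_subset _ _).trans ((erase_subset _ _).trans ((erase_subset _ _).trans (erase_subset _ _)))
  obtain ⟨hτ3₁, hB1₁, hlτ₁, hlcl₁, hd₁, he'₁⟩ :=
    pencilX_D1_data hn hR h he hf hef heb heb' hfb hfb' he1 hfc heb3 hbg hlX hlon hW₁ hc1₁ hc2₁ hl₁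
  obtain ⟨hτ3₂, hB1₂, hlτ₂, hlcl₂, hd₂, he'₂⟩ :=
    pencilX_D1_data hn hR h he hf hef heb heb' hfb hfb' he1 hfc heb3 hbg hlX hlon hW₂ hc1₂ hc2₂ hl₂
  have hWd₁ := hW₁
  simp only [d0DON, mem_filter] at hWd₁
  obtain ⟨hbW₁, hπX₁, hπ2₁, hYeq₁, hWeq₁, hπe₁, hYf₁, hon₁⟩ :=
    d0_demand_data h hn hf hef heb hfb hfb' (e := e) W₁ hWd₁.1 hWd₁.2.1 hWd₁.2.2
  have hWd₂ := hW₂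
  simp only [d0DON, mem_filter] at hWd₂
  obtain ⟨hbW₂, hπX₂, hπ2₂, hYeq₂, hWeq₂, hπe₂, hYf₂, hon₂⟩ :=
    d0_demand_data h hn hf hef heb hfb hfb' (e := e) W₂ hWd₂.1 hWd₂.2.1 hWd₂.2.2
  set π₁ := (W₁.erase b).erase e with hπ₁def
  set π₂ := (W₂.erase b).erase e with hπ₂def
  intro s hs₁ hs₂
  have hπne : π₁ ≠ π₂ := by
    intro heq
    apply hne
    rw [← hWeq₁, ← hYeq₁, ← hWeq₂, ← hYeq₂, heq]
  -- a point `t′ ∈ π₂ ∖ π₁`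
  have ht' : ∃ t' ∈ π₂, t' ∉ π₁ := by
    by_contra hno
    push Not at hno
    exact hπne (eq_of_subset_of_card_le hno (by rw [hπ2₁, hπ2₂])).symm
  obtain ⟨t', ht'₂, ht'₁⟩ := ht'
  have ht'X : t' ∈ X := hπX₂ ht'₂
  have ht'l : t' ≠ l := fun h' => (mem_sdiff.1 hlτ₂).2 (h' ▸ ht'₂)
  have ht'τ : t' ∈ (X \ π₁).erase l := mem_erase.2 ⟨ht'l, mem_sdiff.2 ⟨ht'X, ht'₁⟩⟩
  have hsX : s ∈ X := hπX₁ hs₁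
  -- the plane `T = cl{e, ℓ, t′}`
  have hT3 : rk N (insert e {l, t'}) = 3 := by
    have h1 := rk_insert_le_add_one (N := N) hf (X := insert e ({l, t'} : Finset α))
      (insert_subset he (insert_subset (hXg hlX) (singleton_subset_iff.2 (hXg ht'X))))
    have h2 := rk_le_card' (M := N) (insert e ({l, t'} : Finset α))
    have h3 := card_insert_le e ({l, t'} : Finset α)
    have h5 := card_le_two (a := l) (b := t')
    rw [he'₁ t' ht'τ] at h1
    omega
  -- `X ∖ π₁ ⊆ cl(T)`
  have hTV : insert e ({l, t'} : Finset α) ⊆ insert e (X \ π₁) :=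
    insert_subset (mem_insert_self _ _) (insert_subset (mem_insert_of_mem hlτ₁)
      (singleton_subset_iff.2 (mem_insert_of_mem (mem_of_mem_erase ht'τ))))
  have hτcl : ∀ z ∈ X \ π₁, rk N (insert z (insert e {l, t'})) = rk N (insert e {l, t'}) := by
    intro z hz
    exact rk_insert_eq_of_subset_rk_eq hTV (by rw [hB1₁, hT3]) (by rw [insert_eq_of_mem (mem_insert_of_mem hz)])
  -- `s ∈ cl(T)` (through the plane `cl(π₂ + e) ∋ ℓ`)
  have hTV₂ : insert e ({l, t'} : Finset α) ⊆ insert l (insert e π₂) :=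
    insert_subset (mem_insert_of_mem (mem_insert_self _ _)) (insert_subset (mem_insert_self _ _)
      (singleton_subset_iff.2 (mem_insert_of_mem (mem_insert_of_mem ht'₂))))
  have hscl : rk N (insert s (insert e {l, t'})) = rk N (insert e {l, t'}) :=
    rk_insert_eq_of_subset_rk_eq hTV₂ (by rw [hlcl₂, hT3])
      (by rw [insert_eq_of_mem (mem_insert_of_mem (mem_insert_of_mem hs₂))])
  -- the other point `t` of `π₁` lies in `cl{e, ℓ, s} ⊆ cl(T + s)`
  obtain ⟨t, hts, htπ, hπeq⟩ := pair_eq_insert_of_mem hπ2₁ hs₁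
  have hT'3 : rk N (insert e {l, s}) = 3 := by
    have h1 := rk_insert_le_add_one (N := N) hf (X := insert e ({l, s} : Finset α))
      (insert_subset he (insert_subset (hXg hlX) (singleton_subset_iff.2 (hXg hsX))))
    have h2 := rk_le_card' (M := N) (insert e ({l, s} : Finset α))
    have h3 := card_insert_le e ({l, s} : Finset α)
    have h5 := card_le_two (a := l) (b := s)
    rw [hd₁ s hs₁] at h1
    omega
  have hT'V₃ : insert e ({l, s} : Finset α) ⊆ insert l (insert e π₁) :=
    insert_subset (mem_insert_of_mem (mem_insert_self _ _)) (insert_subset (mem_insert_self _ _)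
      (singleton_subset_iff.2 (mem_insert_of_mem (mem_insert_of_mem hs₁))))
  have htcl : rk N (insert t (insert e {l, s})) = rk N (insert e {l, s}) :=
    rk_insert_eq_of_subset_rk_eq hT'V₃ (by rw [hlcl₁, hT'3])
      (by rw [insert_eq_of_mem (mem_insert_of_mem (mem_insert_of_mem htπ))])
  have htcl' := rk_insert_eq_of_rk_insert_eq_subset' (N := N) (S := insert e {l, s})
    (S' := insert s (insert e {l, t'})) (insert_e_ls_subset_insert_s e l s t') htcl
  -- every point of `X` lies in `cl(T + s + t)`, of rank 3
  have hY3 : rk N (insert t (insert s (insert e {l, t'}))) = 3 := by rw [htcl', hscl, hT3]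
  have hall : ∀ z ∈ X, rk N (insert z (insert t (insert s (insert e {l, t'})))) =
      rk N (insert t (insert s (insert e {l, t'}))) := by
    intro z hz
    by_cases hzπ : z ∈ π₁
    · rw [hπeq] at hzπ
      simp only [mem_insert, mem_singleton] at hzπ
      rcases hzπ with rfl | rfl
      · rw [insert_eq_of_mem (mem_insert_of_mem (mem_insert_self _ _))]
      · rw [insert_eq_of_mem (mem_insert_self _ _)]
    · have h1 := hτcl z (mem_sdiff.2 ⟨hz, hzπ⟩)
      exact rk_insert_eq_of_rk_insert_eq_subset' (N := N) (S := insert e {l, t'})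
        (S' := insert t (insert s (insert e {l, t'}))) ((subset_insert _ _).trans (subset_insert _ _)) h1
  have h5 := rk_union_eq_of_forall_insert_eq (N := N) (Y := insert t (insert s (insert e {l, t'}))) X hall
  have h6 : rk N X ≤ rk N (insert t (insert s (insert e {l, t'})) ∪ X) := rk_mono' subset_union_right
  rw [h5, hY3, hX] at h6
  omega

/-- **AT MOST TWO D1 DEMANDS**: the bad demands with `c1` avoiding `ℓ` number at most two. -/
theorem pencilX_card_X_le_two (hn : (gr N).card = 9) (hR : rk N (gr N) = 5) (h : SeriesPair N b b') {e f : α}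
    (he : e ∈ gr N) (hf : f ∈ gr N) (hef : e ≠ f) (heb : e ≠ b) (heb' : e ≠ b') (hfb : f ≠ b) (hfb' : f ≠ b')
    (he1 : ∀ y ∈ ((((gr N).erase b).erase b').erase f).erase e, rk N {e, y} = 2)
    (hfc : ∀ y ∈ ((((gr N).erase b).erase b').erase f).erase e, rk N (((((gr N).erase b).erase b').erase f).erase y) = 4)
    (hX : rk N (((((gr N).erase b).erase b').erase f).erase e) = 4) (heb3 : rk N {e, b, b'} = 3)
    (hbg : ∀ y ∈ ((((gr N).erase b).erase b').erase f).erase e, rk N {y, b, b'} = 3)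
    {l : α} (hlX : l ∈ ((((gr N).erase b).erase b').erase f).erase e) (hlon : rk N (insert b (insert b' {e, l})) = 3) :
    ((d0DON N b' e f).filter (fun W => (¬ d0c0 N b b' e f W ∧ ¬ (d0c1 N b e f W ∧ d0c2 N b b' e f W)) ∧
        (d0c1 N b e f W ∧ l ∉ W))).card ≤ 2 := by
  set X := ((((gr N).erase b).erase b').erase f).erase e with hXdef
  set BX := (d0DON N b' e f).filter (fun W => (¬ d0c0 N b b' e f W ∧ ¬ (d0c1 N b e f W ∧ d0c2 N b b' e f W)) ∧
        (d0c1 N b e f W ∧ l ∉ W)) with hBXdef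
  have hdata : ∀ W ∈ BX, W ∈ d0DON N b' e f ∧ d0c1 N b e f W ∧ ¬ d0c2 N b b' e f W ∧ l ∉ W := by
    intro W hW
    rw [hBXdef, mem_filter] at hW
    exact ⟨hW.1, hW.2.2.1, fun h2 => hW.2.1.2 ⟨hW.2.2.1, h2⟩, hW.2.2.2⟩
  have hinj : Set.InjOn (fun W => (W.erase b).erase e) (BX : Set (Finset α)) := by
    intro W₁ hW₁ W₂ hW₂ heq
    have hd₁ := (hdata W₁ (mem_coe.1 hW₁)).1
    have hd₂ := (hdata W₂ (mem_coe.1 hW₂)).1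
    simp only [d0DON, mem_filter] at hd₁ hd₂
    obtain ⟨-, -, -, hYeq₁, hWeq₁, -, -, -⟩ :=
      d0_demand_data h hn hf hef heb hfb hfb' (e := e) W₁ hd₁.1 hd₁.2.1 hd₁.2.2
    obtain ⟨-, -, -, hYeq₂, hWeq₂, -, -, -⟩ :=
      d0_demand_data h hn hf hef heb hfb hfb' (e := e) W₂ hd₂.1 hd₂.2.1 hd₂.2.2
    have heq' : (W₁.erase b).erase e = (W₂.erase b).erase e := heq
    rw [← hWeq₁, ← hYeq₁, ← hWeq₂, ← hYeq₂, heq']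
  rw [← card_image_of_injOn hinj]
  apply card_le_two_of_pairwise_disjoint_pairs (X := X) (card_X_eq_five hn h he hf hef heb heb' hfb hfb')
  · intro π hπ
    obtain ⟨W, hW, rfl⟩ := mem_image.1 hπ
    have hd := (hdata W hW).1
    simp only [d0DON, mem_filter] at hd
    obtain ⟨-, hπX, hπ2, -, -, -, -, -⟩ :=
      d0_demand_data h hn hf hef heb hfb hfb' (e := e) W hd.1 hd.2.1 hd.2.2
    exact ⟨hπX, hπ2⟩
  · intro π hπ σ hσ hne u hu huσ
    obtain ⟨W₁, hW₁, rfl⟩ := mem_image.1 hπ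
    obtain ⟨W₂, hW₂, rfl⟩ := mem_image.1 hσ
    obtain ⟨hd₁, hc1₁, hc2₁, hl₁⟩ := hdata W₁ hW₁
    obtain ⟨hd₂, hc1₂, hc2₂, hl₂⟩ := hdata W₂ hW₂
    have hWne : W₁ ≠ W₂ := fun h' => hne (by rw [h'])
    exact pencilX_D1_disjoint hn hR h he hf hef heb heb' hfb hfb' he1 hfc hX heb3 hbg hlX hlon hd₁ hc1₁ hc2₁ hl₁
      hd₂ hc1₂ hc2₂ hl₂ hWne u hu huσ

/-- **THE X-CLASS COUNT**: the bad demands with `c1` avoiding `ℓ` are at most the free bi-bases of the third kind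
avoiding `ℓ` with both pair points off `P_f`. -/
theorem pencilX_card_X_le (hn : (gr N).card = 9) (hR : rk N (gr N) = 5) (h : SeriesPair N b b') {e f : α}
    (he : e ∈ gr N) (hf : f ∈ gr N) (hef : e ≠ f) (heb : e ≠ b) (heb' : e ≠ b') (hfb : f ≠ b) (hfb' : f ≠ b')
    (he1 : ∀ y ∈ ((((gr N).erase b).erase b').erase f).erase e, rk N {e, y} = 2)
    (hfc : ∀ y ∈ ((((gr N).erase b).erase b').erase f).erase e, rk N (((((gr N).erase b).erase b').erase f).erase y) = 4)
    (hX : rk N (((((gr N).erase b).erase b').erase f).erase e) = 4) (heb3 : rk N {e, b, b'} = 3)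
    (hbg : ∀ y ∈ ((((gr N).erase b).erase b').erase f).erase e, rk N {y, b, b'} = 3)
    {l : α} (hlX : l ∈ ((((gr N).erase b).erase b').erase f).erase e) (hlon : rk N (insert b (insert b' {e, l})) = 3) :
    ((d0DON N b' e f).filter (fun W => (¬ d0c0 N b b' e f W ∧ ¬ (d0c1 N b e f W ∧ d0c2 N b b' e f W)) ∧
        (d0c1 N b e f W ∧ l ∉ W))).card ≤
      ((biIndepSets N 4).filter (fun B =>
        (((f ∈ B ∧ b' ∉ B) ∧ (e ∈ B ∧ b ∉ B)) ∧
          ¬ (insert b (B.erase f) ∈ biIndepSets N 4 ∧ rk N (insert b (insert b' (B.erase f))) = 4)) ∧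
        (l ∉ B ∧ ∀ z ∈ (B.erase e).erase f, rk N (insert f (insert e {l, z})) = 4))).card := by
  by_cases hemp : (d0DON N b' e f).filter (fun W => (¬ d0c0 N b b' e f W ∧ ¬ (d0c1 N b e f W ∧ d0c2 N b b' e f W)) ∧
      (d0c1 N b e f W ∧ l ∉ W)) = ∅
  · rw [hemp, card_empty]; exact Nat.zero_le _
  · obtain ⟨W, hW⟩ := nonempty_iff_ne_empty.2 hemp
    rw [mem_filter] at hW
    have h2 := pencilX_two_le_card_free_X hn hR h he hf hef heb heb' hfb hfb' he1 hfc hX heb3 hbg hlX hlon hW.1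
      hW.2.2.1 (fun h2 => hW.2.1.2 ⟨hW.2.2.1, h2⟩) hW.2.2.2
    have h1 := pencilX_card_X_le_two hn hR h he hf hef heb heb' hfb hfb' he1 hfc hX heb3 hbg hlX hlon
    omega

end StarSharpPencilF

end PercRepro.Cogirth
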